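import HarnessLib
import Summits.QuantumFields.YangMills.Theorems.PencilRigidityHypercubicLimitDefs
import Summits.QuantumFields.YangMills.Theorems.LangevinControlUVOSLegsFromFemtoAndGapDefs
import Summits.QuantumFields.YangMills.Theorems.LangevinControlUVOSLegsFromFemtoAndGapStubAssemblyLatticeDist
import Summits.QuantumFields.YangMills.Theorems.LangevinControlUVOSLegsFromFemtoAndGapStubAssemblyLowDegree
import Summits.QuantumFields.YangMills.Theorems.LangevinControlUVOSLegsFromFemtoAndGapStubAssemblyNontrivial

/-!
# `HypercubicLimit`, line `conditional-mean-telescoping` — (S) leg: non-triviality of a scaled limit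

Sub-goal SG4 of crux `stmt-QuantumFields-8646` (thesis `MirrorModularBoosts.HypercubicLimit`): along a sequence of
couplings `βₖ`, tori `Lₖ` and spacings `aₖ`, if the NORMALISED centred lattice two-point distributions
`(cₖ aₖ⁴)² · latticeDist … 2` converge on `⁰𝒮` to `S₁ 2`, the limit is canonically centred (`S₁ 1 = 0`), and the
scaled smeared truncated two-point function at the reflection-symmetric pair `(θv, v)` is eventually bounded below,
`ε ≤ (cₖ aₖ⁴)² Q2(θv, v)`, then `S₁` satisfies the crux's (complex, time-ordered) non-triviality clause.

This is the sibling route's `OSLegsFromFemtoAndGap.twoPointNontrivial_of_lowerBounds` with the real scalar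
`(cₖ aₖ⁴)²` inserted in the approximants and the floor taken as an `∀ᶠ` hypothesis: on the real tensor
`θv ⊗ v ∈ ⁰𝒮` (`isOffDiagonal_of_halfSpaces`) the k-th approximant is the real number `(cₖ aₖ⁴)² Q2(θv, v) ≥ ε`
(`latticeDist_two_tensor`), so `Re S₁ 2 (θv ⊗ v) ≥ ε > 0 = S₁ 1 (θv) S₁ 1 (v)`, and the tree certificate
`HypercubicLimit.Negative.twoPointNontrivial_of_real` produces the witnesses.
-/

set_option autoImplicit false

noncomputable section

open scoped SchwartzMap ENNReal
open MeasureTheory Filter Topology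
open Literature.MathematicalPhysics.AQFT Literature.MathematicalPhysics.QuantumLattice
open Literature.MathematicalPhysics.QuantumFieldTheory
open Literature.Probability.LatticeModels (box Site)
open Summit.QuantumFields.YangMills.Theorems.HypercubicLimit.Negative
  (torusPlaquette torusDensity rpSquare influence)
open Summit.QuantumFields.YangMills.Theorems.OSLegsFromFemtoAndGap (torusMomentStr latticeDistStr latticeDist)
open Summit.QuantumFields.YangMills.Cruxes.OSLegsFromFemtoAndGap.DlrCollarTransfer (Q2 Q3)
open Summit.QuantumFields.YangMills.Theorems.HypercubicLimit.Negative
  (tensor₁ tensor₂ isTensorOf_tensor₂ twoPointNontrivial_of_real isOffDiagonal_of_halfSpaces tsupport_thetaTest_neg)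
open Summit.QuantumFields.YangMills.Theorems.OSLegsFromFemtoAndGap (latticeDist_two_tensor)

namespace Summit.QuantumFields.YangMills.Cruxes.HypercubicLimit.ConditionalMeanTelescoping

/-- **SG4: non-triviality of a scaled limit from a scaled `Q2(θv, v)` floor.**  If the normalised centred lattice
two-point distributions `(cₖ aₖ⁴)² · latticeDist … 2` converge on `⁰𝒮` to `S₁ 2`, `S₁ 1 = 0`, and eventually
`ε ≤ (cₖ aₖ⁴)² Q2(θv, v)` for one real `v` supported in positive times and some `ε > 0`, then the one-field family
`S₁` has a time-ordered pair `F₁, G₁` with `S₁ 2 (θF̄₁ ⊗ G₁) ≠ S₁ 1 (θF̄₁) S₁ 1 (G₁)`. -/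
theorem twoPointNontrivial_of_scaledQ2 :
    ∀ (G : Type) [Group G] [TopologicalSpace G] [IsTopologicalGroup G] [CompactSpace G] [MeasurableSpace G]
      [BorelSpace G] (r : LatticeRep G) (βs : ℕ → ℝ) (Ls : ℕ → ℕ) (as cs : ℕ → ℝ)
      (S₁ : SchwingerFamily (EuclideanSpace ℝ (Fin 4))) (v : 𝓢(EuclideanSpace ℝ (Fin 4), ℝ)) (ε : ℝ),
      0 < ε → tsupport v ⊆ {y : EuclideanSpace ℝ (Fin 4) | 0 < y 0} →
      (∀ F : 𝓢((Fin 1 → EuclideanSpace ℝ (Fin 4)), ℂ), S₁ 1 F = 0) →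
      (∀ F : 𝓢((Fin 2 → EuclideanSpace ℝ (Fin 4)), ℂ), IsOffDiagonal F →
        Tendsto (fun k => (((cs k * as k ^ 4) ^ 2 : ℝ) : ℂ) *
          latticeDist r.ρ (βs k) (Ls k) (as k) r.curvature.F (wilsonTorusMean r.ρ (βs k) (Ls k) r.curvature.F) 2 F)
          atTop (𝓝 (S₁ 2 F))) →
      (∀ᶠ k in atTop, ε ≤ (cs k * as k ^ 4) ^ 2 * Q2 G r (βs k) (Ls k) (as k) (thetaTest 4 v) v) →
      ∃ (F₁ G₁ : 𝓢((Fin 1 → EuclideanSpace ℝ (Fin 4)), ℂ)) (H₁ : 𝓢((Fin (1 + 1) → EuclideanSpace ℝ (Fin 4)), ℂ)),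
        IsTimeOrdered F₁ ∧ IsTimeOrdered G₁ ∧ IsAppendTensorOf H₁ (osAdjoint F₁) G₁ ∧
          S₁ (1 + 1) H₁ ≠ S₁ 1 (osAdjoint F₁) * S₁ 1 G₁ := by
  intro G _ _ _ _ _ _ r βs Ls as cs S₁ v ε hε hv h1 hconv hev
  -- adapted from `OSLegsFromFemtoAndGap.twoPointNontrivial_of_lowerBounds` (sibling route, scalar inserted)
  have hu := tsupport_thetaTest_neg hv
  suffices hne : S₁.toLabelled (1 + 1) (fun _ => ()) (tensor₂ (thetaTest 4 v) v) ≠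
      S₁.toLabelled 1 (fun _ => ()) (tensor₁ (thetaTest 4 v)) *
        S₁.toLabelled 1 (fun _ => ()) (tensor₁ v) by
    simpa only [SchwingerFamily.toLabelled_apply] using twoPointNontrivial_of_real S₁.toLabelled () hu hv hne
  simp only [SchwingerFamily.toLabelled_apply, h1, mul_zero]
  -- the two-point value is the limit of the real numbers `(cₖ aₖ⁴)² Q2(θv, v) ≥ ε`
  have hT : IsOffDiagonal (tensor₂ (thetaTest 4 v) v) :=
    isOffDiagonal_of_halfSpaces hu hv (isTensorOf_tensor₂ _ _)
  have hlim := hconv (tensor₂ (thetaTest 4 v) v) hT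
  have hQ2 : ∀ k, latticeDist r.ρ (βs k) (Ls k) (as k) r.curvature.F
      (wilsonTorusMean r.ρ (βs k) (Ls k) r.curvature.F) 2 (tensor₂ (thetaTest 4 v) v) =
        (Q2 G r (βs k) (Ls k) (as k) (thetaTest 4 v) v : ℂ) := fun k =>
    latticeDist_two_tensor r _ _ _ (thetaTest 4 v) v _ (isTensorOf_tensor₂ _ _)
  have hre : Tendsto (fun k => ((((cs k * as k ^ 4) ^ 2 : ℝ) : ℂ) *
      latticeDist r.ρ (βs k) (Ls k) (as k) r.curvature.F
        (wilsonTorusMean r.ρ (βs k) (Ls k) r.curvature.F) 2 (tensor₂ (thetaTest 4 v) v)).re) atTop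
      (𝓝 (S₁ 2 (tensor₂ (thetaTest 4 v) v)).re) := (Complex.continuous_re.tendsto _).comp hlim
  have hge : ε ≤ (S₁ 2 (tensor₂ (thetaTest 4 v) v)).re :=
    ge_of_tendsto hre (hev.mono fun k hk => by
      rw [hQ2 k, ← Complex.ofReal_mul, Complex.ofReal_re]; exact hk)
  intro h0
  have : (S₁ 2 (tensor₂ (thetaTest 4 v) v)).re = 0 := by
    rw [show S₁ 2 (tensor₂ (thetaTest 4 v) v) = 0 from h0, Complex.zero_re]
  linarith

end Summit.QuantumFields.YangMills.Cruxes.HypercubicLimit.ConditionalMeanTelescoping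

end
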